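import Summits.ResolutionOfSingularities.ResolutionOfSingularities.Theorems.HilbertSamuelEliminationSigmaMaxModificationsCorridor3WLadderIsoTailsFrameCompletionIdeal
import Summits.ResolutionOfSingularities.ResolutionOfSingularities.Theorems.HilbertSamuelEliminationSigmaMaxModificationsCorridor3WLadderIsoTailsFormalFrameBase
import Summits.ResolutionOfSingularities.ResolutionOfSingularities.Theorems.HilbertSamuelEliminationSigmaMaxModificationsCorridor3WLadderIsoTailsFormalFrameStepGen
import Literature.RingTheory.CompleteLocalRings.FormalImmersionCompletion
import Literature.AlgebraicGeometry.Resolution.AlterationsSingularComponentsGlue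
import Literature.AlgebraicGeometry.Resolution.AdicCompletionRegular
import Literature.AlgebraicGeometry.Resolution.PowerSeriesRegularLocal
import Literature.AlgebraicGeometry.Resolution.RegularLocalRingsProofs
import Literature.RingTheory.HilbertSamuel.HilbertSamuelCompletion
import Literature.AlgebraicGeometry.Resolution.MarkedIdealsEtale
import HarnessLib

/-!
# [OURS · L1 W4.2] D14 ROUTE G v2 «ARC LIMIT» — object G2f, part 1: **every frame of the tower is a formal coordinate system**
# (a local homomorphism `ψ : R → κ⟦X_0, …, X_d⟧` from a regular local ring of embedding dimension `d + 1`, onto on residue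
# fields and on cotangent spaces, induces `R̂ ≅ κ⟦X⟧`; hence the formal model, the Hilbert function and the `t`-saturation of
# `ψ(ker σ)·κ⟦X⟧` at EVERY stage of the frame tower)
# (crux `SigmaMaxModifications` stmt-ResolutionOfSingularities-18506 / conjunct stmt-…-19249; kernel K1
# `IdeasL1C5.IsoFreeRationalTailsImpossible` in every embedding dimension; res-L1-w42-lead-1 `ROUTE-G-ARCLIMIT.md` §1 «ψ_n induces
# `R̂_n ≃ S`, so `S/J_n ≃ 𝒪̂_{X_n,x_n}` and `HS(S/J_n) = HS(𝒪_{X_n,x_n}) = ν` for all n — NEARNESS», §4 G2f)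

Prover res-L1-w42-stub-2 (gen 5), taking the G2f FINAL ASSEMBLY left by res-type-001 (STATUS 2026-08-27T15:13:46Z). Helper file
`--supports stmt-ResolutionOfSingularities-19249 --as helper`; kernel only, no definitions, no named fact. OURS (cell res-hironaka,
slot W4.2); NOT statements of [Hironaka2017] nor of [CossartJannsenSaito2020] / [CossartPiltant2009]. AI-written; AI review is weaker than
expert review.

## Why this file

The frames `ψ_n : R_n → S = κ⟦X_0, …, X_d⟧` produced along a free-rational tail (res-D-pv-010 `FormalFrame.exists_frameStep`,
res-type-071 `FormalFrameGen.stepFrame` / G2a-FL) come with: `IsLocalHom ψ_n`, `ψ_n (x 0) = X 0`,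
`ψ_n (x i) − X i − λ_i X 0 ∈ 𝔪_S²` (`i ≠ 0`) for a regular system of parameters `x` of `R_n`, and residue surjectivity
`∀ a, ∃ r, ψ_n r − C a ∈ 𝔪_S` — but NOT with Cohen coordinates `Ψ_n : S ≃ R̂_n` (only the base frame of res-type-038's
`exists_baseFrame_of_rsop` has them). Lead-1's limit inequality G2c (`ArcLimit.hilbertSamuelFun_arcLimit`) needs, at EVERY stage, the
Hilbert function of `S ⧸ ψ_n(ker σ_n)S` (nearness) and the `t`-saturation of `ψ_n(ker σ_n)S`; both follow once `ψ_n` is known to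
induce `R̂_n ≅ S`. This file proves that and packages the three consequences.

## What is proved (namespace `…Theorems.SigmaMaxModificationsCorridor3.IsoTailsHS`)

* `exists_cohenEquiv_of_frame` — `R` regular local with `emb.dim R = d + 1`, `ψ : R →+* κ⟦X_0..X_d⟧` a local homomorphism, onto on
  residue fields (`∀ a, ∃ r, ψ r − C a ∈ 𝔪_S`) and on cotangent spaces (`𝔪_S ≤ ψ(𝔪_R)S + 𝔪_S²`) ⟹
  `∃ Ψ : κ⟦X⟧ ≃+* R̂, ∀ r, Ψ (ψ r) = r` — EGA IV 17.4.4 / Matsumura 8.4 (tree `surjective_mk_pow_comp`,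
  `surjective_completionMap_iff_of_isLocalHom`: `R̂ → κ⟦X⟧^ = κ⟦X⟧` is onto) and «a surjection of a Noetherian local domain onto a
  domain of the same dimension is injective» (tree `RingHom.injective_of_surjective_of_ringKrullDim_le`; `dim R̂ = dim R = d + 1 =
  dim κ⟦X⟧`).
* `exists_cohenEquiv_of_frame_of_rsop` — the same with the cotangent hypothesis in the tower's currency: a regular system of
  parameters `x` with `ψ (x 0) = X 0` and `ψ (x i) − X i − C (λ i) * X 0 ∈ 𝔪_S²` for `i ≠ 0`.
* `isLocalRing_and_nonempty_frameModelEquiv_of_frame` — for a presentation `σ : R ↠ A` of a Noetherian local ring: `S ⧸ ψ(ker σ)S` is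
  local and `≃+* Â` (res-type-001's `nonempty_frameModelEquiv_of_surjective` fed `Ψ`).
* `hilbertFun_quotient_map_frame_eq` — hence `H^{(0)}(S ⧸ ψ(ker σ)S) = H^{(0)}(A)` (tree `hilbertFun_adicCompletion`; the local-ring
  instance on the quotient is any — e.g. the first component of the previous theorem).
* `mem_map_frame_of_mul_mem` — and `ψ(ker σ)S` is `ψ a`-saturated whenever `ker σ` is `a`-saturated (`R → R̂` flat, Matsumura 7.4 (iii):
  tree `Ideal.colon_singleton_map_le_of_flat`); with `a = x 0`, `ψ a = X 0 = t` this is the hypothesis `hsat` of G2c.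

[OURS · L1 W4.2; AI-written] [cite: Matsumura1987, Thm. 8.4, Thm. 8.11, Thm. 7.4 (iii)]
-/

set_option linter.dupNamespace false

noncomputable section

open IsLocalRing MvPowerSeries
open Literature.AlgebraicGeometry.Resolution Literature.RingTheory.HilbertSamuel Literature.RingTheory.CompleteLocalRings
open Summit.ResolutionOfSingularities.ResolutionOfSingularities.Cruxes.SigmaMaxModifications.IdeasL1C5

namespace Summit.ResolutionOfSingularities.ResolutionOfSingularities.Theorems.SigmaMaxModificationsCorridor3.IsoTailsHS

universe u

/-! ## §1. A frame is a formal coordinate system -/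

/-- Residue surjectivity against constants gives residue surjectivity against all series. [folklore] -/
theorem exists_sub_mem_maximalIdeal_of_frame {R : Type u} [CommRing R] {d : ℕ} {K : Type u} [Field K]
    (ψ : R →+* MvPowerSeries (Fin (d + 1)) K)
    (hres : ∀ a : K, ∃ r : R, ψ r - C a ∈ maximalIdeal (MvPowerSeries (Fin (d + 1)) K))
    (b : MvPowerSeries (Fin (d + 1)) K) : ∃ r : R, ψ r - b ∈ maximalIdeal (MvPowerSeries (Fin (d + 1)) K) := by
  obtain ⟨r, hr⟩ := hres (constantCoeff b)
  refine ⟨r, ?_⟩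
  have hb : b - C (constantCoeff b) ∈ maximalIdeal (MvPowerSeries (Fin (d + 1)) K) := by
    rw [FormalFrameGen.mem_maximalIdeal_iff, map_sub, constantCoeff_C, sub_self]
  have e : ψ r - b = (ψ r - C (constantCoeff b)) - (b - C (constantCoeff b)) := by ring
  rw [e]
  exact Ideal.sub_mem _ hr hb

/-- **A FRAME IS A FORMAL COORDINATE SYSTEM.** Let `R` be a regular local ring of embedding dimension `d + 1`, `K` a field and
`ψ : R →+* K⟦X_0, …, X_d⟧` a local homomorphism which is onto on residue fields (`∀ a, ∃ r, ψ r − C a ∈ 𝔪`) and on cotangent spaces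
(`𝔪 ≤ ψ(𝔪_R)·K⟦X⟧ + 𝔪²`). Then `ψ` extends to an isomorphism of the `𝔪_R`-adic completion: there is `Ψ : K⟦X⟧ ≃+* R̂` with
`Ψ (ψ r) = r` for all `r ∈ R`. Proof: the level-compatible map `R̂ → K⟦X⟧^` is onto (cotangent criterion, Matsumura 8.4) and
`K⟦X⟧^ = K⟦X⟧`; a surjection of the Noetherian local domain `R̂` (regular) onto the domain `K⟦X⟧` of the same dimension `d + 1` is
injective. [cite: Matsumura1987, Thm. 8.4] -/
theorem exists_cohenEquiv_of_frame {R : Type u} [CommRing R] [IsRegularLocalRing R] {d : ℕ}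
    (hd : (maximalIdeal R).spanFinrank = d + 1) {K : Type u} [Field K]
    (ψ : R →+* MvPowerSeries (Fin (d + 1)) K) [IsLocalHom ψ]
    (hres : ∀ a : K, ∃ r : R, ψ r - C a ∈ maximalIdeal (MvPowerSeries (Fin (d + 1)) K))
    (hcot : maximalIdeal (MvPowerSeries (Fin (d + 1)) K) ≤
      (maximalIdeal R).map ψ ⊔ maximalIdeal (MvPowerSeries (Fin (d + 1)) K) ^ 2) :
    ∃ Ψ : MvPowerSeries (Fin (d + 1)) K ≃+* AdicCompletion (maximalIdeal R) R,
      ∀ r, Ψ (ψ r) = algebraMap R (AdicCompletion (maximalIdeal R) R) r := by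
  -- `K⟦X⟧` is complete, regular local of dimension `d + 1`
  haveI : IsAdicComplete (maximalIdeal (MvPowerSeries (Fin (d + 1)) K)) (MvPowerSeries (Fin (d + 1)) K) := by
    rw [maximalIdeal_mvPowerSeries_eq_span K (Fin (d + 1))]
    infer_instance
  haveI : IsRegularLocalRing (MvPowerSeries (Fin (d + 1)) K) := isRegularLocalRing_mvPowerSeries K (Fin (d + 1))
  have hφ : (maximalIdeal R).map ψ ≤ maximalIdeal (MvPowerSeries (Fin (d + 1)) K) := IsLocalRing.map_maximalIdeal_le ψ
  have hres' : ∀ b : MvPowerSeries (Fin (d + 1)) K, ∃ a : R, ψ a - b ∈ maximalIdeal (MvPowerSeries (Fin (d + 1)) K) :=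
    exists_sub_mem_maximalIdeal_of_frame ψ hres
  have hcot' : ∀ y ∈ maximalIdeal (MvPowerSeries (Fin (d + 1)) K), ∃ x ∈ maximalIdeal R,
      ψ x - y ∈ maximalIdeal (MvPowerSeries (Fin (d + 1)) K) ^ 2 :=
    exists_mem_sub_mem_sq_of_le_sup_sq ψ hφ hres' hcot
  -- level-wise surjectivity (cotangent criterion)
  have hlev : ∀ k : ℕ, Function.Surjective ((Ideal.Quotient.mk (maximalIdeal (MvPowerSeries (Fin (d + 1)) K) ^ k)).comp ψ) :=
    surjective_mk_pow_comp ψ hφ hres' hcot'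
  -- the map of completions, onto
  obtain ⟨χ, hχ⟩ := exists_completionMap ψ hφ
  have hsurj : Function.Surjective χ := (surjective_completionMap_iff_of_isLocalHom ψ hχ).mpr hlev
  let eS : MvPowerSeries (Fin (d + 1)) K ≃ₐ[MvPowerSeries (Fin (d + 1)) K]
      AdicCompletion (maximalIdeal (MvPowerSeries (Fin (d + 1)) K)) (MvPowerSeries (Fin (d + 1)) K) :=
    AdicCompletion.ofAlgEquiv (maximalIdeal (MvPowerSeries (Fin (d + 1)) K))
  -- dimensions and domains
  haveI : IsRegularLocalRing (AdicCompletion (maximalIdeal R) R) := isRegularLocalRing_adicCompletion R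
  haveI : IsDomain (AdicCompletion (maximalIdeal R) R) := isDomain_of_isRegularLocalRing _
  haveI : IsRegularLocalRing (AdicCompletion (maximalIdeal (MvPowerSeries (Fin (d + 1)) K)) (MvPowerSeries (Fin (d + 1)) K)) :=
    isRegularLocalRing_adicCompletion _
  haveI : IsDomain (AdicCompletion (maximalIdeal (MvPowerSeries (Fin (d + 1)) K)) (MvPowerSeries (Fin (d + 1)) K)) :=
    isDomain_of_isRegularLocalRing _
  have hdim : ringKrullDim (AdicCompletion (maximalIdeal R) R) ≤
      ringKrullDim (AdicCompletion (maximalIdeal (MvPowerSeries (Fin (d + 1)) K)) (MvPowerSeries (Fin (d + 1)) K)) := by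
    rw [ringKrullDim_adicCompletion, ← ringKrullDim_eq_of_ringEquiv eS.toRingEquiv, FormalFrame.ringKrullDim_eq_of_spanFinrank_eq hd,
      ringKrullDim_mvPowerSeries, Nat.card_eq_fintype_card, Fintype.card_fin]
  have hinj : Function.Injective χ := RingHom.injective_of_surjective_of_ringKrullDim_le χ hsurj hdim
  let Ψ' : AdicCompletion (maximalIdeal R) R ≃+*
      AdicCompletion (maximalIdeal (MvPowerSeries (Fin (d + 1)) K)) (MvPowerSeries (Fin (d + 1)) K) :=
    RingEquiv.ofBijective χ ⟨hinj, hsurj⟩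
  refine ⟨eS.toRingEquiv.trans Ψ'.symm, fun r => ?_⟩
  rw [RingEquiv.trans_apply, RingEquiv.symm_apply_eq]
  show eS (ψ r) = χ (AdicCompletion.of (maximalIdeal R) R r)
  rw [completionMap_of ψ hφ hχ r]
  exact AdicCompletion.ofAlgEquiv_apply (maximalIdeal (MvPowerSeries (Fin (d + 1)) K)) (ψ r)

/-- **The same with the cotangent hypothesis in the tower's currency**: a regular system of parameters `x` of `R` with
`ψ (x 0) = X 0` and `ψ (x i) − X i − C (λ i) * X 0 ∈ 𝔪²` for `i ≠ 0` (the clauses of res-D-pv-010's / res-type-071's frame steps, and of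
the base frame with `λ = 0`). [cite: Matsumura1987, Thm. 8.4] -/
theorem exists_cohenEquiv_of_frame_of_rsop {R : Type u} [CommRing R] [IsRegularLocalRing R] {d : ℕ}
    (hd : (maximalIdeal R).spanFinrank = d + 1) (x : Fin (d + 1) → R) (hx : Ideal.span (Set.range x) = maximalIdeal R)
    {K : Type u} [Field K] (ψ : R →+* MvPowerSeries (Fin (d + 1)) K) [IsLocalHom ψ]
    (hψ0 : ψ (x 0) = X 0) (lam : Fin (d + 1) → K)
    (hψi : ∀ i, i ≠ 0 → ψ (x i) - X i - C (lam i) * X 0 ∈ maximalIdeal (MvPowerSeries (Fin (d + 1)) K) ^ 2)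
    (hres : ∀ a : K, ∃ r : R, ψ r - C a ∈ maximalIdeal (MvPowerSeries (Fin (d + 1)) K)) :
    ∃ Ψ : MvPowerSeries (Fin (d + 1)) K ≃+* AdicCompletion (maximalIdeal R) R,
      ∀ r, Ψ (ψ r) = algebraMap R (AdicCompletion (maximalIdeal R) R) r := by
  refine exists_cohenEquiv_of_frame hd ψ hres ?_
  have hxm : ∀ i, x i ∈ maximalIdeal R := fun i => by
    rw [← hx]; exact Ideal.subset_span ⟨i, rfl⟩
  have hX0 : (X 0 : MvPowerSeries (Fin (d + 1)) K) ∈ (maximalIdeal R).map ψ := by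
    rw [← hψ0]; exact Ideal.mem_map_of_mem ψ (hxm 0)
  -- every variable lies in `ψ(𝔪_R)S + 𝔪²`
  have hXi : ∀ i, (X i : MvPowerSeries (Fin (d + 1)) K) ∈
      (maximalIdeal R).map ψ ⊔ maximalIdeal (MvPowerSeries (Fin (d + 1)) K) ^ 2 := by
    intro i
    by_cases hi : i = 0
    · subst hi; exact Ideal.mem_sup_left hX0
    · have e : (X i : MvPowerSeries (Fin (d + 1)) K) = (ψ (x i) - C (lam i) * X 0) - (ψ (x i) - X i - C (lam i) * X 0) := by ring
      rw [e]
      exact Ideal.sub_mem _ (Ideal.mem_sup_left (Ideal.sub_mem _ (Ideal.mem_map_of_mem ψ (hxm i))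
        (Ideal.mul_mem_left _ _ hX0))) (Ideal.mem_sup_right (hψi i hi))
  exact (maximalIdeal_mvPowerSeries_eq_span K (Fin (d + 1))).le.trans (Ideal.span_le.mpr (by rintro _ ⟨i, rfl⟩; exact hXi i))

/-! ## §2. Consequences at a stage: the formal model, the Hilbert function, the saturation -/

/-- **THE FORMAL MODEL OF A STAGE THROUGH ANY FRAME.** With `ψ` as in `exists_cohenEquiv_of_frame` and a presentation `σ : R ↠ A` of a
Noetherian local ring, `J := ψ(ker σ)·K⟦X⟧` presents the completion: `K⟦X⟧ ⧸ J` is local and `≃+* Â` (res-type-001's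
`nonempty_frameModelEquiv_of_surjective` fed the Cohen coordinates of §1). [cite: Matsumura1987, Thm. 8.11] -/
theorem isLocalRing_and_nonempty_frameModelEquiv_of_frame {R : Type u} [CommRing R] [IsRegularLocalRing R] {d : ℕ}
    (hd : (maximalIdeal R).spanFinrank = d + 1) {K : Type u} [Field K]
    (ψ : R →+* MvPowerSeries (Fin (d + 1)) K) [IsLocalHom ψ]
    (hres : ∀ a : K, ∃ r : R, ψ r - C a ∈ maximalIdeal (MvPowerSeries (Fin (d + 1)) K))
    (hcot : maximalIdeal (MvPowerSeries (Fin (d + 1)) K) ≤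
      (maximalIdeal R).map ψ ⊔ maximalIdeal (MvPowerSeries (Fin (d + 1)) K) ^ 2)
    {A : Type u} [CommRing A] [IsLocalRing A] [IsNoetherianRing A] (σ : R →+* A) (hσ : Function.Surjective σ) :
    IsLocalRing (MvPowerSeries (Fin (d + 1)) K ⧸ (RingHom.ker σ).map ψ) ∧
      Nonempty ((MvPowerSeries (Fin (d + 1)) K ⧸ (RingHom.ker σ).map ψ) ≃+* AdicCompletion (maximalIdeal A) A) := by
  obtain ⟨Ψ, hΨ⟩ := exists_cohenEquiv_of_frame hd ψ hres hcot
  exact nonempty_frameModelEquiv_of_surjective Ψ ψ hΨ σ hσ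

/-- **NEARNESS IS READ IN THE FRAME**: `H^{(0)}(K⟦X⟧ ⧸ ψ(ker σ)K⟦X⟧) = H^{(0)}(A)` for a presentation `σ : R ↠ A` of a Noetherian local
ring through a frame `ψ` (formal model `≃ Â`, and `H^{(0)}(Â) = H^{(0)}(A)`). [cite: Matsumura1987, Thm. 8.11] -/
theorem hilbertFun_quotient_map_frame_eq {R : Type u} [CommRing R] [IsRegularLocalRing R] {d : ℕ}
    (hd : (maximalIdeal R).spanFinrank = d + 1) {K : Type u} [Field K]
    (ψ : R →+* MvPowerSeries (Fin (d + 1)) K) [IsLocalHom ψ]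
    (hres : ∀ a : K, ∃ r : R, ψ r - C a ∈ maximalIdeal (MvPowerSeries (Fin (d + 1)) K))
    (hcot : maximalIdeal (MvPowerSeries (Fin (d + 1)) K) ≤
      (maximalIdeal R).map ψ ⊔ maximalIdeal (MvPowerSeries (Fin (d + 1)) K) ^ 2)
    {A : Type u} [CommRing A] [IsLocalRing A] [IsNoetherianRing A] (σ : R →+* A) (hσ : Function.Surjective σ)
    [IsLocalRing (MvPowerSeries (Fin (d + 1)) K ⧸ (RingHom.ker σ).map ψ)] :
    hilbertFun (MvPowerSeries (Fin (d + 1)) K ⧸ (RingHom.ker σ).map ψ) = hilbertFun A := by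
  obtain ⟨-, ⟨e⟩⟩ := isLocalRing_and_nonempty_frameModelEquiv_of_frame hd ψ hres hcot σ hσ
  haveI : IsRegularLocalRing (MvPowerSeries (Fin (d + 1)) K) := isRegularLocalRing_mvPowerSeries K (Fin (d + 1))
  haveI : IsNoetherianRing (MvPowerSeries (Fin (d + 1)) K ⧸ (RingHom.ker σ).map ψ) :=
    Ideal.Quotient.isNoetherianRing _
  rw [hilbertFun_eq_of_ringEquiv e, hilbertFun_adicCompletion]

/-- **SATURATION IS READ IN THE FRAME**: if `ker σ` is `a`-saturated in `R` (`a r ∈ ker σ ⇒ r ∈ ker σ`, i.e. `σ a` is a nonzerodivisor of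
`A`), then `ψ(ker σ)·K⟦X⟧` is `ψ a`-saturated (`R → R̂` is flat, so `(I R̂ : a) = (I : a) R̂`, Matsumura 7.4 (iii); transport along
`Ψ`). With `a = x 0`, `ψ a = X 0 = t` this is the hypothesis `hsat` of lead-1's `ArcLimit.hilbertSamuelFun_arcLimit`.
[cite: Matsumura1987, Thm. 7.4 (iii)] -/
theorem mem_map_frame_of_mul_mem {R : Type u} [CommRing R] [IsRegularLocalRing R] {d : ℕ}
    (hd : (maximalIdeal R).spanFinrank = d + 1) {K : Type u} [Field K]
    (ψ : R →+* MvPowerSeries (Fin (d + 1)) K) [IsLocalHom ψ]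
    (hres : ∀ a : K, ∃ r : R, ψ r - C a ∈ maximalIdeal (MvPowerSeries (Fin (d + 1)) K))
    (hcot : maximalIdeal (MvPowerSeries (Fin (d + 1)) K) ≤
      (maximalIdeal R).map ψ ⊔ maximalIdeal (MvPowerSeries (Fin (d + 1)) K) ^ 2)
    {I : Ideal R} {a : R} (hIa : ∀ r, a * r ∈ I → r ∈ I)
    {f : MvPowerSeries (Fin (d + 1)) K} (hf : ψ a * f ∈ I.map ψ) : f ∈ I.map ψ := by
  obtain ⟨Ψ, hΨ⟩ := exists_cohenEquiv_of_frame hd ψ hres hcot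
  set Rh := AdicCompletion (maximalIdeal R) R with hRh
  -- `ψ = Ψ⁻¹ ∘ (R → R̂)`, so `I.map ψ = (I R̂).map Ψ⁻¹`
  have hψ : ψ = (Ψ.symm : Rh →+* MvPowerSeries (Fin (d + 1)) K).comp (algebraMap R Rh) := by
    refine RingHom.ext fun r => ?_
    simp only [RingHom.comp_apply, RingHom.coe_coe]
    rw [← hΨ, RingEquiv.symm_apply_apply]
  have hmap : I.map ψ = (I.map (algebraMap R Rh)).map (Ψ.symm : Rh →+* MvPowerSeries (Fin (d + 1)) K) := by
    rw [Ideal.map_map, ← hψ]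
  -- saturation in `R̂` by flatness
  have hcol : (I.map (algebraMap R Rh)).colon {algebraMap R Rh a} ≤ I.map (algebraMap R Rh) := by
    refine (Ideal.colon_singleton_map_le_of_flat (A := R) (B := Rh) I a).trans (Ideal.map_mono ?_)
    intro r hr
    rw [Submodule.mem_colon_singleton, smul_eq_mul] at hr
    exact hIa r (by simpa only [mul_comm] using hr)
  -- transport along `Ψ`
  have hΨf : Ψ (ψ a) * Ψ f ∈ I.map (algebraMap R Rh) := by
    rw [← map_mul]
    have h := Ideal.mem_map_of_mem (Ψ : MvPowerSeries (Fin (d + 1)) K →+* Rh) hf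
    rw [hmap, Ideal.map_map] at h
    simpa [Ideal.map_id] using h
  have hΨf' : Ψ f ∈ I.map (algebraMap R Rh) := by
    refine hcol ?_
    rw [Submodule.mem_colon_singleton, smul_eq_mul, ← hΨ, mul_comm]
    exact hΨf
  have h := Ideal.mem_map_of_mem (Ψ.symm : Rh →+* MvPowerSeries (Fin (d + 1)) K) hΨf'
  rw [← hmap] at h
  simpa using h

end Summit.ResolutionOfSingularities.ResolutionOfSingularities.Theorems.SigmaMaxModificationsCorridor3.IsoTailsHS

end
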